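import Summits.CriticalPhenomena.PercolationContinuityZ3.Theorems.PercNearOneGluingNoHeavyPcintBSMRZ4QSRowsA
import HarnessLib

/-!
# PCINT lane, PHASE 11 (site plane method for `d = 4`, reach-4 pieces (two-turn family)): kernel checks 4/4 of the checkpoint chain for site `ℤ^4`

Cell `prim-pcint`, seat `prim-pcint-1` (gen 18); memo `run/shared/lean/prim/pcint/T-FIBRE-ROUTE.md` §PHASE 11.
Instance `Z4QS`: `d = 4 = 2 + 2` (`k = 2` time axes, the transverse plane), SITE percolation, reach-4 pieces,
9-point law `A/DA = [12, 25, 35, 80, 696, 80, 35, 25, 12]/1000`, horizon `N = 1000` in `20` chunks of `50` (window half-width `250`),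
Fourier tail (cut-off data, `θ₀ = 1/3`) `T = 3781802960/10^12`, cell `p = 3770/10^4`. `rowLE (hrowFrom starts[c] (2L)) starts[c+1]`.
-/

namespace Summit.CriticalPhenomena.PercolationContinuityZ3.Theorems.Pcint.BSMR.Z4QS

open Summit.CriticalPhenomena.PercolationContinuityZ3.Theorems.Pcint.BSMR Summit.CriticalPhenomena.PercolationContinuityZ3.Theorems.Pcint.BSMX Summit.CriticalPhenomena.PercolationContinuityZ3.Theorems.Pcint.BSM

set_option maxHeartbeats 0 in
set_option maxRecDepth 65536 in
/-- Checkpoint `16` dominates the rows continued from checkpoint `15` (the law is restated to keep the statement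
instance-specific). -/
theorem hn_15 : lawA = [12, 25, 35, 80, 696, 80, 35, 25, 12] ∧ ∀ c ∈ (((List.range 19).drop 15).take 1),
    BSMX.rowLE (hrowFrom 4 lawA 1000 1000000000000 (starts.getD c []) (2 * 50)) (starts.getD (c + 1) []) = true := by
  refine ⟨rfl, ?_⟩
  decide +kernel

set_option maxHeartbeats 0 in
set_option maxRecDepth 65536 in
/-- Checkpoint `17` dominates the rows continued from checkpoint `16` (the law is restated to keep the statement
instance-specific). -/
theorem hn_16 : lawA = [12, 25, 35, 80, 696, 80, 35, 25, 12] ∧ ∀ c ∈ (((List.range 19).drop 16).take 1),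
    BSMX.rowLE (hrowFrom 4 lawA 1000 1000000000000 (starts.getD c []) (2 * 50)) (starts.getD (c + 1) []) = true := by
  refine ⟨rfl, ?_⟩
  decide +kernel

set_option maxHeartbeats 0 in
set_option maxRecDepth 65536 in
/-- Checkpoint `18` dominates the rows continued from checkpoint `17` (the law is restated to keep the statement
instance-specific). -/
theorem hn_17 : lawA = [12, 25, 35, 80, 696, 80, 35, 25, 12] ∧ ∀ c ∈ (((List.range 19).drop 17).take 1),
    BSMX.rowLE (hrowFrom 4 lawA 1000 1000000000000 (starts.getD c []) (2 * 50)) (starts.getD (c + 1) []) = true := by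
  refine ⟨rfl, ?_⟩
  decide +kernel

set_option maxHeartbeats 0 in
set_option maxRecDepth 65536 in
/-- Checkpoint `19` dominates the rows continued from checkpoint `18` (the law is restated to keep the statement
instance-specific). -/
theorem hn_18 : lawA = [12, 25, 35, 80, 696, 80, 35, 25, 12] ∧ ∀ c ∈ ((List.range 19).drop 18),
    BSMX.rowLE (hrowFrom 4 lawA 1000 1000000000000 (starts.getD c []) (2 * 50)) (starts.getD (c + 1) []) = true := by
  refine ⟨rfl, ?_⟩
  decide +kernel


end Summit.CriticalPhenomena.PercolationContinuityZ3.Theorems.Pcint.BSMR.Z4QS
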